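import Mathlib
import HarnessLib
import Literature.NumberTheory.LFunctions.BourgainTheorem4Assembly
import Literature.NumberTheory.LFunctions.BourgainBilinearReduction

/-!
# Bourgain's Theorem 4 (`F = log`): the frontier after the §3 reductions

Topic `Literature/NumberTheory/LFunctions`. A one-theorem file recording, in the vocabulary of
`BourgainTheorem4Assembly.lean`, what the discharge of the named fact
`Literature.NumberTheory.LFunctions.Bourgain2017_theorem4_log` (Bourgain, J. Amer. Math. Soc. 30
(2017), Theorem 4, eq. (3.19), for `F = log`) rests on after the proved reductions of §3 of the paper
(`BourgainDecouplingMeanValueProofs.lean`: Corollary 3 ⇐ Theorem 2; `BourgainTheorem2Induction.lean`: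
Theorem 2 ⇐ (2.23), the [B-G] induction (2.24)–(2.27); `BourgainBilinearReduction.lean`: (2.23) ⇐
(2.22) ⇐ (2.10), the Taylor reduction (2.13)–(2.23) and the non-degeneracy (2.11) of the Taylor
curve): the hypothesis `hC3` (Corollary 3 (2.28)) of
`Literature.NumberTheory.LFunctions.Bourgain2017_theorem4_log_of_reduction` is replaced by `h210`,
Bourgain's decoupling bound (2.10) for the curves `(t, t², φ₃, φ₄)` satisfying (2.11) (the content of
Theorem 1 of the paper for `d = 4` over the Bourgain–Demeter `L⁶` decoupling (1.5), eqs.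
(1.2)–(2.10)). The other three inputs are unchanged: the Huxley–Watt reduction (3.4) (`h34`), the
second spacing bound before (3.11) (`h311`), Huxley's (3.15) (`h315`).

## References

* J. Bourgain, *Decoupling, exponential sums and the Riemann zeta function*, J. Amer. Math. Soc.
  30 (2017), 205–224 — Theorem 4 (3.19); §3 (2.10)–(2.28); §4 (3.3)–(3.18).
-/

noncomputable section

open Complex MeasureTheory Finset
open scoped Real

namespace Literature.NumberTheory.LFunctions

/-- **Bourgain 2017, Theorem 4 for `F = log` from (3.4), (3.11), (3.15) and the decoupling bound
(2.10).** `Literature.NumberTheory.LFunctions.Bourgain2017_theorem4_log` follows from the Huxley–Watt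
reduction data and bound (3.4) (`h34`), the second spacing bound before (3.11) (`h311`), Huxley's
(3.15) (`h315`) — exactly as in `Literature.NumberTheory.LFunctions.Bourgain2017_theorem4_log_of_reduction`
— and, in place of Corollary 3 (2.28), Bourgain's decoupling bound (2.10) for curves
`(t, t², φ₃, φ₄)` satisfying (2.11) (`h210`, written out as in
`Literature.NumberTheory.LFunctions.Bourgain2017_corollary3_of_eq210`, which supplies `hC3`).
[cite: BourgainJAMS2017, Theorem 4, eq. (3.19); §3 eq. (2.10); Corollary 3, eq. (2.28)] -/
theorem Bourgain2017_theorem4_log_of_reduction_of_eq210 {c : ℝ} (hc : 0 < c) (hc1 : c ≤ 1)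
    (Q H : ℝ → ℝ → ℝ → ℕ) (α : ℝ → ℝ → ℝ → ℂ) (𝓘 : ℝ → ℝ → ℝ → Finset ℕ)
    (x : ℝ → ℝ → ℝ → ℕ → Fin 4 → ℝ)
    (h34 : ∃ C₀ T₀ : ℝ, ∀ T M N : ℝ, T₀ ≤ T → M ≤ Real.sqrt T → 1 < N → N < M →
      (bourgainR c M N T : ℝ) ≤ N → N ≤ (bourgainR c M N T : ℝ) ^ 2 →
        (bourgainR c M N T : ℝ) ≤ Q T M N ∧
        N * Q T M N / (bourgainR c M N T : ℝ) ^ 2 ≤ H T M N ∧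
        (H T M N : ℝ) ≤ C₀ * N * Q T M N / (bourgainR c M N T : ℝ) ^ 2 ∧
        ((𝓘 T M N).card : ℝ) ≤ C₀ * M * (bourgainR c M N T : ℝ) ^ 2 / (N * (Q T M N : ℝ) ^ 2) ∧
        ‖α T M N‖ ≤ 1 ∧
        (∀ I ∈ 𝓘 T M N, ∀ k, |x T M N I k| ≤
          bourgainXBound (((bourgainR c M N T : ℝ) / Q T M N) ^ 2 * Real.sqrt (H T M N)) k) ∧
        ‖bourgainSum Real.log T M‖ ≤ C₀ * (M * Real.log N / Real.sqrt N +
          (bourgainR c M N T : ℝ) * Real.log N ^ 2 / Real.sqrt (Q T M N) *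
            ∑ I ∈ 𝓘 T M N, (‖bourgainHSum (H T M N) (α T M N) (x T M N I)‖ +
              (Q T M N : ℝ) / (bourgainR c M N T : ℝ))))
    (h311 : ∃ C₁ T₁ : ℝ, ∀ T M N : ℝ, T₁ ≤ T → M ≤ Real.sqrt T →
      N = M * T ^ (-(2 / 7) : ℝ) → 1 < N → N < M →
      (bourgainR c M N T : ℝ) ≤ N → N ≤ (bourgainR c M N T : ℝ) ^ 2 →
      (Q T M N : ℝ) < (bourgainR c M N T : ℝ) ^ (2 / 3 : ℝ) * N ^ (1 / 3 : ℝ) →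
        (bourgainSecondSpacingCount (𝓘 T M N) (x T M N) (H T M N) 1 : ℝ) ≤
          C₁ * (1 / (3 * (H T M N : ℝ) ^ 2)) *
            ((Q T M N : ℝ) ^ 2 / (6 * (bourgainR c M N T : ℝ) ^ 2 * (H T M N : ℝ) ^ 2)) *
            (M / N) ^ 2 * ((Q T M N : ℝ) / (bourgainR c M N T : ℝ)) ^ 4)
    (h315 : ∃ C₂ T₂ : ℝ, ∀ T M N : ℝ, T₂ ≤ T → M ≤ Real.sqrt T → 1 < N → N < M →
      (bourgainR c M N T : ℝ) ≤ N → N ≤ (bourgainR c M N T : ℝ) ^ 2 →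
      (Q T M N : ℝ) < (bourgainR c M N T : ℝ) ^ (2 / 3 : ℝ) * N ^ (1 / 3 : ℝ) →
      ∀ V : ℝ, (V = N / Q T M N ∧ N / Q T M N ≤ (bourgainR c M N T : ℝ) ^ 4 / N ^ 2) ∨
          V = (bourgainR c M N T : ℝ) ^ 4 / N ^ 2 →
        V * (bourgainSecondSpacingCount (𝓘 T M N) (x T M N) (H T M N) V : ℝ) ≤
          C₂ * (V * M * (bourgainR c M N T : ℝ) ^ 2 / (N * (Q T M N : ℝ) ^ 2) +
            (1 / (3 * (H T M N : ℝ) ^ 2)) *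
              ((Q T M N : ℝ) ^ 2 / (6 * (bourgainR c M N T : ℝ) ^ 2 * (H T M N : ℝ) ^ 2)) *
              ((Q T M N : ℝ) ^ 2 / (6 * (bourgainR c M N T : ℝ) ^ 2 * (H T M N : ℝ))) ^
                (2 / 3 : ℝ) * (M / N) ^ 2) *
            ((Q T M N : ℝ) / (bourgainR c M N T : ℝ)) ^ 4)
    (h210 : ∀ ε c B : ℝ, 0 < ε → 0 < c → ∃ C : ℝ,
      ∀ (φ₃ φ₃₁ φ₃₂ φ₃₃ φ₃₄ φ₃₅ φ₄ φ₄₁ φ₄₂ φ₄₃ φ₄₄ φ₄₅ : ℝ → ℝ),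
        (∀ t ∈ Set.Icc (0 : ℝ) 1,
          HasDerivAt φ₃ (φ₃₁ t) t ∧ HasDerivAt φ₃₁ (φ₃₂ t) t ∧ HasDerivAt φ₃₂ (φ₃₃ t) t ∧
            HasDerivAt φ₃₃ (φ₃₄ t) t ∧ HasDerivAt φ₃₄ (φ₃₅ t) t ∧
          HasDerivAt φ₄ (φ₄₁ t) t ∧ HasDerivAt φ₄₁ (φ₄₂ t) t ∧ HasDerivAt φ₄₂ (φ₄₃ t) t ∧
            HasDerivAt φ₄₃ (φ₄₄ t) t ∧ HasDerivAt φ₄₄ (φ₄₅ t) t) →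
        (∀ t ∈ Set.Icc (0 : ℝ) 1,
          |φ₃ t| ≤ B ∧ |φ₃₁ t| ≤ B ∧ |φ₃₂ t| ≤ B ∧ |φ₃₃ t| ≤ B ∧ |φ₃₄ t| ≤ B ∧ |φ₃₅ t| ≤ B ∧
          |φ₄ t| ≤ B ∧ |φ₄₁ t| ≤ B ∧ |φ₄₂ t| ≤ B ∧ |φ₄₃ t| ≤ B ∧ |φ₄₄ t| ≤ B ∧ |φ₄₅ t| ≤ B) →
        (∀ t ∈ Set.Icc (0 : ℝ) 1, c ≤ |φ₃₃ t|) →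
        (∀ s ∈ Set.Icc (0 : ℝ) 1, ∀ t ∈ Set.Icc (0 : ℝ) 1,
          c ≤ |φ₃₃ s * φ₄₄ t - φ₄₃ s * φ₃₄ t|) →
        ∀ M : ℕ, 1 ≤ M → ∀ a b a' b' : ℕ, a ≤ b → b < a' → a' ≤ b' → b' ≤ M →
          (M : ℝ) ≤ 4 * ((a' : ℝ) - b) → ∀ c₀ c₀' : ℝ,
          (∫ y in Set.Icc ![0, 0, c₀, c₀'] ![1, 1, c₀ + (M : ℝ) ^ 2, c₀' + M],
            ‖∑ m ∈ Finset.Icc a b, Complex.exp (2 * ↑π * I *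
                ↑((m : ℝ) * y 0 + (m : ℝ) ^ 2 * y 1 + φ₃ ((m : ℝ) / M) * y 2 + φ₄ ((m : ℝ) / M) * y 3))‖ ^ 6 *
              ‖∑ m ∈ Finset.Icc a' b', Complex.exp (2 * ↑π * I *
                ↑((m : ℝ) * y 0 + (m : ℝ) ^ 2 * y 1 + φ₃ ((m : ℝ) / M) * y 2 + φ₄ ((m : ℝ) / M) * y 3))‖ ^ 6) ≤
            C * (M : ℝ) ^ (9 + ε)) :
    Bourgain2017_theorem4_log :=
  Bourgain2017_theorem4_log_of_reduction hc hc1 Q H α 𝓘 x h34 h311 h315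
    (Bourgain2017_corollary3_of_eq210 h210)

end Literature.NumberTheory.LFunctions
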